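import Summits.Ventures.PercRepro0.Events
import Summits.Ventures.PercRepro0.Invariance
import Summits.Ventures.PercRepro0.PlanarT2

/-!
# The left–right crossing event of the rectangle `B_n` and the union bound (seat p1, gen 1)

Lean twin, on the cell's `Defs.lean`, of the second step of T2-assembly-p4-v2 §4 (Lemma 2.2 + the union
bound + F2), OFF the declaration path (lead 23:00:52Z):

* `rect n` = `B_n = {0,…,n+1} × {0,…,n}`, `leftCol n` / `rightCol n` its two end columns
  (P6-dualcrossing-p1-v1 §1), `LR n` = the event «some open walk with all vertices in `B_n` joins the left
  column to the right column» (the `LR_n` of P6 §1 / T2 §1 (P6a), walks in the open graph of `ω`);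
* `LR n` is measurable (a countable union of cylinder events) and increasing;
* `LR_subset_biUnion`: `LR_n ⊆ ⋃_{x ∈ leftCol} {x ↔ x + ∂Λ_{n+1}}` — T2 Lemma 2.2, with the END vertex of the
  crossing as the witness (`‖y − x‖_∞ = n+1` exactly), so no intermediate-value step is needed;
* `P_LR_le`: `P_p(LR_n) ≤ (n+1) · P_p(0 ↔ ∂Λ_{n+1})` (union bound over the `n+1` vertices of the left column +
  F2 translation invariance `P_shiftConfig_preimage`);
* `T2_Planar_of_LR`: PlanarT2's `T2_Planar_of` with its crossing-bound hypothesis replaced by the P6(a) form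
  `½ ≤ P_½(LR_n)` (P6-dualcrossing-p1-v1 Theorem 4.4 gives `= ½`).

Imports only landed PercRepro0 modules (which import Mathlib). No instances, no notation, no axioms.
-/

namespace Summit.Ventures.PercRepro0.Crossing

open Summit.Ventures.PercRepro0.Defs MeasureTheory ProbabilityTheory unitInterval Set
open scoped ENNReal

/-! ## The rectangle and the crossing event -/

/-- The point `(a, b)` of `ℤ²` as a vertex of `𝕃²` (`Vertex 2 = Fin 2 → ℤ`). -/
def pt (a b : ℤ) : Vertex 2 := ![a, b]

/-- First coordinate of `pt a b`. -/
@[simp] theorem pt_zero (a b : ℤ) : pt a b 0 = a := rfl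

/-- Second coordinate of `pt a b`. -/
@[simp] theorem pt_one (a b : ℤ) : pt a b 1 = b := rfl

/-- Every vertex of `𝕃²` is `pt (x 0) (x 1)`. -/
theorem eq_pt (x : Vertex 2) : x = pt (x 0) (x 1) := by
  funext i
  fin_cases i <;> rfl

/-- `pt` is injective. -/
theorem pt_injective2 {a b a' b' : ℤ} (h : pt a b = pt a' b') : a = a' ∧ b = b' :=
  ⟨by have := congrFun h 0; simpa using this, by have := congrFun h 1; simpa using this⟩

/-- The rectangle `B_n = {0,…,n+1} × {0,…,n}` (P6-dualcrossing-p1-v1 §1). -/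
def rect (n : ℕ) : Set (Vertex 2) := {x | 0 ≤ x 0 ∧ x 0 ≤ (n : ℤ) + 1 ∧ 0 ≤ x 1 ∧ x 1 ≤ n}

/-- The left column `{0} × {0,…,n}` of `B_n`. -/
def leftCol (n : ℕ) : Set (Vertex 2) := {x | x 0 = 0 ∧ 0 ≤ x 1 ∧ x 1 ≤ n}

/-- The right column `{n+1} × {0,…,n}` of `B_n`. -/
def rightCol (n : ℕ) : Set (Vertex 2) := {x | x 0 = (n : ℤ) + 1 ∧ 0 ≤ x 1 ∧ x 1 ≤ n}

/-- The left column lies in the rectangle. -/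
theorem leftCol_subset_rect (n : ℕ) : leftCol n ⊆ rect n := by
  rintro x ⟨h0, h1, h2⟩
  exact ⟨by omega, by omega, h1, h2⟩

/-- The right column lies in the rectangle. -/
theorem rightCol_subset_rect (n : ℕ) : rightCol n ⊆ rect n := by
  rintro x ⟨h0, h1, h2⟩
  exact ⟨by omega, by omega, h1, h2⟩

/-- `LR_n`: some open walk with all its vertices in `B_n` joins the left column to the right column
(P6-dualcrossing-p1-v1 §1; T2-assembly-p4-v2 §1 (P6a)). -/
def LR (n : ℕ) : Set (Config 2) :=
  {ω | ∃ x ∈ leftCol n, ∃ y ∈ rightCol n, ∃ w : (openGraph 2 ω).Walk x y, ∀ v ∈ w.support, v ∈ rect n}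

/-- `LR_n` in terms of lattice walks whose edges are open. -/
theorem mem_LR_iff (n : ℕ) (ω : Config 2) :
    ω ∈ LR n ↔ ∃ x ∈ leftCol n, ∃ y ∈ rightCol n, ∃ w : (lattice 2).Walk x y,
      (∀ v ∈ w.support, v ∈ rect n) ∧ ∀ e ∈ w.edges, e ∈ ω := by
  constructor
  · rintro ⟨x, hx, y, hy, w, hw⟩
    have hE : ∀ e ∈ w.edges, e ∈ (lattice 2).edgeSet := by
      intro e he
      have h := w.edges_subset_edgeSet he
      rw [openGraph, SimpleGraph.edgeSet_fromEdgeSet] at h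
      exact h.1.2
    refine ⟨x, hx, y, hy, w.transfer (lattice 2) hE, ?_, ?_⟩
    · intro v hv
      rw [SimpleGraph.Walk.support_transfer] at hv
      exact hw v hv
    · intro e he
      rw [SimpleGraph.Walk.edges_transfer] at he
      have h := w.edges_subset_edgeSet he
      rw [openGraph, SimpleGraph.edgeSet_fromEdgeSet] at h
      exact h.1.1
  · rintro ⟨x, hx, y, hy, w, hw, hopen⟩
    have hE : ∀ e ∈ w.edges, e ∈ (openGraph 2 ω).edgeSet := by
      intro e he
      rw [openGraph, SimpleGraph.edgeSet_fromEdgeSet]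
      exact ⟨⟨hopen e he, w.edges_subset_edgeSet he⟩,
        SimpleGraph.not_isDiag_of_mem_edgeSet _ (w.edges_subset_edgeSet he)⟩
    refine ⟨x, hx, y, hy, w.transfer (openGraph 2 ω) hE, ?_⟩
    intro v hv
    rw [SimpleGraph.Walk.support_transfer] at hv
    exact hw v hv

/-- `LR_n` is increasing in the configuration. -/
theorem isUpperSet_LR (n : ℕ) : IsUpperSet (LR n) := by
  intro ω ω' hωω' hω
  rw [mem_LR_iff] at hω ⊢
  obtain ⟨x, hx, y, hy, w, hw, hopen⟩ := hω
  exact ⟨x, hx, y, hy, w, hw, fun e he => hωω' (hopen e he)⟩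

/-- `LR_n` is measurable: a countable union (over the end vertices and the lattice walks inside `B_n`) of
finite intersections of the cylinder events `{e ∈ ω}`. -/
theorem measurableSet_LR (n : ℕ) : MeasurableSet (LR n) := by
  have : LR n = ⋃ x ∈ leftCol n, ⋃ y ∈ rightCol n,
      ⋃ w ∈ {w : (lattice 2).Walk x y | ∀ v ∈ w.support, v ∈ rect n},
        ⋂ e ∈ {e | e ∈ w.edges}, {ω : Config 2 | e ∈ ω} := by
    ext ω
    simp only [mem_LR_iff, Set.mem_iUnion, Set.mem_iInter, Set.mem_setOf_eq, exists_prop]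
  rw [this]
  refine MeasurableSet.biUnion (Set.to_countable _) fun x _ => ?_
  refine MeasurableSet.biUnion (Set.to_countable _) fun y _ => ?_
  haveI : Countable ((lattice 2).Walk x y) := SimpleGraph.Walk.support_injective.countable
  refine MeasurableSet.biUnion (Set.to_countable _) fun w _ => ?_
  exact MeasurableSet.biInter (Set.to_countable _) fun e _ => measurableSet_mem e

/-! ## T2 Lemma 2.2: a crossing reaches sup-distance `n+1` from its starting vertex -/

/-- The difference of a right-column vertex and a left-column vertex lies on the sphere `∂Λ_{n+1}`. -/
theorem sub_mem_boundary {n : ℕ} {x y : Vertex 2} (hx : x ∈ leftCol n) (hy : y ∈ rightCol n) :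
    y - x ∈ boundary 2 (n + 1) := by
  obtain ⟨hx0, hx1, hx2⟩ := hx
  obtain ⟨hy0, hy1, hy2⟩ := hy
  refine ⟨Fin.forall_fin_two.2 ⟨?_, ?_⟩, ⟨0, ?_⟩⟩
  · simp only [Pi.sub_apply, Nat.cast_add, Nat.cast_one]
    rw [abs_le]; constructor <;> omega
  · simp only [Pi.sub_apply, Nat.cast_add, Nat.cast_one]
    rw [abs_le]; constructor <;> omega
  · simp only [Pi.sub_apply, Nat.cast_add, Nat.cast_one]
    rw [hy0, hx0, sub_zero, abs_of_nonneg (by omega)]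

/-- **T2-assembly Lemma 2.2**: `LR_n ⊆ ⋃_{x ∈ leftCol} {x ↔ x + ∂Λ_{n+1}}`, the right-hand events written as
the translates `shiftConfig x ⁻¹' {0 ↔ ∂Λ_{n+1}}` (F2). The witness is the end vertex of the crossing. -/
theorem LR_subset_biUnion (n : ℕ) :
    LR n ⊆ ⋃ x ∈ leftCol n, shiftConfig x ⁻¹' toBoundary 2 (n + 1) := by
  rintro ω ⟨x, hx, y, hy, w, _⟩
  simp only [Set.mem_iUnion, Set.mem_preimage, toBoundary, Set.mem_setOf_eq, exists_prop]
  refine ⟨x, hx, y - x, sub_mem_boundary hx hy, ?_⟩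
  rw [conn_shiftConfig, zero_add, sub_add_cancel]
  exact ⟨w⟩

/-! ## The union bound -/

/-- The left column as a finset: the image of `{0,…,n}` under `j ↦ (0, j)`. -/
def leftColFinset (n : ℕ) : Finset (Vertex 2) := (Finset.range (n + 1)).image fun j : ℕ => pt 0 j

/-- The finset `leftColFinset n` is the left column. -/
theorem coe_leftColFinset (n : ℕ) : (leftColFinset n : Set (Vertex 2)) = leftCol n := by
  ext x
  simp only [leftColFinset, Finset.coe_image, Finset.coe_range, Set.mem_image, Set.mem_Iio, leftCol,
    Set.mem_setOf_eq]
  constructor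
  · rintro ⟨j, hj, rfl⟩
    exact ⟨rfl, by simp, by simp; omega⟩
  · rintro ⟨h0, h1, h2⟩
    refine ⟨(x 1).toNat, by omega, ?_⟩
    funext i
    fin_cases i
    · simpa [pt] using h0.symm
    · show ((x 1).toNat : ℤ) = x 1
      exact Int.toNat_of_nonneg h1

/-- The left column has `n+1` vertices. -/
theorem card_leftColFinset (n : ℕ) : (leftColFinset n).card = n + 1 := by
  rw [leftColFinset, Finset.card_image_of_injective, Finset.card_range]
  intro a b hab
  have := (pt_injective2 hab).2
  exact_mod_cast this

/-- **The union bound with F2**: `P_p(LR_n) ≤ (n+1) · P_p(0 ↔ ∂Λ_{n+1})` (T2-assembly §4 Step 2). -/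
theorem P_LR_le (n : ℕ) (p : I) :
    P 2 p (LR n) ≤ ((n : ℝ≥0∞) + 1) * P 2 p (toBoundary 2 (n + 1)) := by
  calc P 2 p (LR n)
      ≤ P 2 p (⋃ x ∈ leftColFinset n, shiftConfig x ⁻¹' toBoundary 2 (n + 1)) := by
        apply measure_mono
        refine (LR_subset_biUnion n).trans ?_
        rw [← coe_leftColFinset]
        exact le_refl _
    _ ≤ ∑ x ∈ leftColFinset n, P 2 p (shiftConfig x ⁻¹' toBoundary 2 (n + 1)) :=
        measure_biUnion_finset_le _ _
    _ = ∑ _x ∈ leftColFinset n, P 2 p (toBoundary 2 (n + 1)) := by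
        refine Finset.sum_congr rfl fun x _ => ?_
        exact P_shiftConfig_preimage x p (measurableSet_toBoundary (n + 1))
    _ = ((n : ℝ≥0∞) + 1) * P 2 p (toBoundary 2 (n + 1)) := by
        rw [Finset.sum_const, card_leftColFinset, nsmul_eq_mul]
        push_cast
        ring

/-- The union bound, real form. -/
theorem P_LR_le_real (n : ℕ) (p : I) :
    (P 2 p (LR n)).toReal ≤ ((n : ℝ) + 1) * (P 2 p (toBoundary 2 (n + 1))).toReal := by
  have h := P_LR_le n p
  have hfin : ((n : ℝ≥0∞) + 1) * P 2 p (toBoundary 2 (n + 1)) ≠ ⊤ :=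
    ENNReal.mul_ne_top (by simp) (measure_ne_top _ _)
  have h' := ENNReal.toReal_mono hfin h
  rw [ENNReal.toReal_mul] at h'
  have hn : ((n : ℝ≥0∞) + 1).toReal = (n : ℝ) + 1 := by
    rw [ENNReal.toReal_add (by simp) (by simp)]
    simp
  rw [hn] at h'
  exact h'

/-- PlanarT2's crossing-bound hypothesis `hcross` follows from `½ ≤ P_½(LR_n)` for every `n ≥ 1`
(P6-dualcrossing-p1-v1 Theorem 4.4 gives `P_½(LR_n) = ½`). -/
theorem hcross_of_LR (hLR : ∀ n : ℕ, 1 ≤ n → (1 : ℝ) / 2 ≤ (P 2 (clamp (1 / 2)) (LR n)).toReal) :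
    ∀ n : ℕ, 1 ≤ n →
      (1 : ℝ) / 2 ≤ ((n : ℝ) + 1) * (P 2 (clamp (1 / 2)) (toBoundary 2 (n + 1))).toReal :=
  fun n hn => (hLR n hn).trans (P_LR_le_real n (clamp (1 / 2)))

/-- **T2 with the P6(a) input in its paper form.** PlanarT2's `T2_Planar_of`, its crossing-bound hypothesis
replaced by `½ ≤ P_½(LR_n)` for all `n ≥ 1` (P6-dualcrossing-p1-v1 Theorem 4.4). The remaining inputs are
L1 (monotonicity of `θ_2`), `θ_2(1) > 0`, P1 HARRIS and P5 SHARPNESS. -/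
theorem T2_Planar_of_LR (hmono : MonotoneOn (theta 2) (Icc 0 1)) (hone : 0 < theta 2 1)
    (hP1 : P1_Harris) (hP5 : P5_Sharpness 2)
    (hLR : ∀ n : ℕ, 1 ≤ n → (1 : ℝ) / 2 ≤ (P 2 (clamp (1 / 2)) (LR n)).toReal) : T2_Planar :=
  Summit.Ventures.PercRepro0.PlanarT2.T2_Planar_of hmono hone hP1 hP5 (hcross_of_LR hLR)

end Summit.Ventures.PercRepro0.Crossing
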